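import Mathlib.Analysis.Calculus.FDeriv.Symmetric
import Mathlib.Analysis.Calculus.FDeriv.Mul
import Mathlib.Analysis.SpecialFunctions.Trigonometric.Deriv
import Literature.Analysis.FunctionSpaces.RegularizedDistance
import HarnessLib

/-!
# Iterated directional derivatives: Leibniz rules, Schwarz, plane waves

Topic `Analysis/FunctionSpaces`. Extends the API of
`Literature.Analysis.FunctionSpaces.iterDirDeriv` (`RegularizedDistance.lean`: words of
directions, head = outermost derivative) on a real normed space `E` — folklore multivariable
calculus needed by the plane-wave potentials of the convex-integration scheme
(`Literature/Analysis/FluidPDE/ConvexIntegration2D*.lean`; Chiodaroli–De Lellis–Kreml 2015,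
proof of Prop. 4.1), stated in full generality:

* order one (`iterDirDeriv [v]`): sum, difference, negation, constant multiple, the Leibniz
  rules `iterDirDeriv_singleton_mul` / `_smul`, for merely differentiable functions (the word
  versions in `RegularizedDistance.lean` assume smoothness);
* **Schwarz**: `iterDirDeriv_singleton_comm` and the invariance `iterDirDeriv_perm` of
  `iterDirDeriv β f` under permutations of the word `β` for `C^∞` functions (Mathlib has the
  symmetric second derivative `IsSymmSndFDerivAt`, and permutation invariance of
  `iteratedFDeriv` only for analytic functions);
* the exact **third-order Leibniz expansion** `iterDirDeriv_three_mul` (eight terms) and the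
  remainder bound `abs_iterDirDeriv_three_mul_sub_le`: `|∂³(φκ) - φ ∂³κ| ≤ 7 M_φ M_κ`;
* **plane waves**: derivatives of `x ↦ c sin(ℓ x)`, `c cos(ℓ x)` for a continuous linear
  `ℓ : E →L[ℝ] ℝ`, the case analysis `iterDirDeriv_sin_clm_cases`, the bound
  `|∂^β (c sin ℓ)| ≤ |c| ∏_{v ∈ β} |ℓ v|`, and `∂³ (c sin ℓ) = -(c ℓv₁ ℓv₂ ℓv₃) cos ℓ`;
* `prod_norm_get`: `∏ᵢ ‖βᵢ‖ = (β.map ‖·‖).prod` (to use `norm_iterDirDeriv_le` with words).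

## References

* L. C. Evans, *Partial Differential Equations*, 2nd ed. (2010), App. C (calculus facts).
-/

noncomputable section

open Set Function
open scoped ContDiff

namespace Literature.Analysis.FunctionSpaces

section General

variable {E : Type*} [NormedAddCommGroup E] [NormedSpace ℝ E]
variable {F : Type*} [NormedAddCommGroup F] [NormedSpace ℝ F]

/-- `∂_v f (x) = Df(x) v` for the one-letter word. [folklore] -/
theorem iterDirDeriv_singleton_apply (v : E) (f : E → F) (x : E) :
    iterDirDeriv [v] f x = fderiv ℝ f x v := rfl

/-- `∂_{v β} f = ∂_v (∂_β f)`. [folklore] -/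
theorem iterDirDeriv_cons_eq_singleton (v : E) (β : List E) (f : E → F) :
    iterDirDeriv (v :: β) f = iterDirDeriv [v] (iterDirDeriv β f) := rfl

/-- Word derivatives of a smooth function are differentiable. [folklore] -/
theorem differentiable_iterDirDeriv {f : E → F} (hf : ContDiff ℝ ∞ f) (β : List E) :
    Differentiable ℝ (iterDirDeriv β f) :=
  (contDiff_iterDirDeriv hf β).differentiable (by simp)

/-! ### Order one -/

/-- `∂_v (f + g) = ∂_v f + ∂_v g` for differentiable `f, g`. [folklore] -/
theorem iterDirDeriv_singleton_add {f g : E → F} (hf : Differentiable ℝ f)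
    (hg : Differentiable ℝ g) (v : E) :
    iterDirDeriv [v] (fun x => f x + g x) = fun x => iterDirDeriv [v] f x + iterDirDeriv [v] g x := by
  funext x
  simp only [iterDirDeriv_singleton_apply]
  rw [fderiv_fun_add (hf x) (hg x)]
  rfl

/-- `∂_v (f - g) = ∂_v f - ∂_v g` for differentiable `f, g`. [folklore] -/
theorem iterDirDeriv_singleton_sub {f g : E → F} (hf : Differentiable ℝ f)
    (hg : Differentiable ℝ g) (v : E) :
    iterDirDeriv [v] (fun x => f x - g x) = fun x => iterDirDeriv [v] f x - iterDirDeriv [v] g x := by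
  funext x
  simp only [iterDirDeriv_singleton_apply]
  rw [fderiv_fun_sub (hf x) (hg x)]
  rfl

/-- `∂_v (-f) = -∂_v f`. [folklore] -/
theorem iterDirDeriv_singleton_neg (f : E → F) (v : E) :
    iterDirDeriv [v] (fun x => -f x) = fun x => -iterDirDeriv [v] f x := by
  funext x
  simp only [iterDirDeriv_singleton_apply]
  rw [fderiv_fun_neg]
  rfl

/-- `∂_v (c f) = c ∂_v f` for differentiable scalar `f`. [folklore] -/
theorem iterDirDeriv_singleton_const_mul {f : E → ℝ} (hf : Differentiable ℝ f) (c : ℝ) (v : E) :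
    iterDirDeriv [v] (fun x => c * f x) = fun x => c * iterDirDeriv [v] f x := by
  funext x
  simp only [iterDirDeriv_singleton_apply]
  rw [show (fun x => c * f x) = fun x => c • f x from rfl, fderiv_fun_const_smul (hf x)]
  rfl

/-- **Leibniz rule** `∂_v (f g) = (∂_v f) g + f ∂_v g` for differentiable scalar `f, g`.
[folklore] -/
theorem iterDirDeriv_singleton_mul {f g : E → ℝ} (hf : Differentiable ℝ f) (hg : Differentiable ℝ g)
    (v : E) : iterDirDeriv [v] (fun x => f x * g x) =
      fun x => iterDirDeriv [v] f x * g x + f x * iterDirDeriv [v] g x := by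
  funext x
  simp only [iterDirDeriv_singleton_apply]
  rw [fderiv_fun_mul (hf x) (hg x)]
  simp only [add_apply, smul_apply, smul_eq_mul]
  ring

/-- Leibniz rule `∂_v (f • g) = (∂_v f) • g + f • ∂_v g` for a differentiable scalar times a
differentiable vector function. [folklore] -/
theorem iterDirDeriv_singleton_smul {f : E → ℝ} {g : E → F} (hf : Differentiable ℝ f)
    (hg : Differentiable ℝ g) (v : E) : iterDirDeriv [v] (fun x => f x • g x) =
      fun x => iterDirDeriv [v] f x • g x + f x • iterDirDeriv [v] g x := by
  funext x
  simp only [iterDirDeriv_singleton_apply]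
  rw [fderiv_fun_smul (hf x) (hg x)]
  simp only [add_apply, smul_apply, ContinuousLinearMap.smulRight_apply]
  abel

/-! ### Schwarz -/

/-- **Schwarz.** Directional derivatives of a smooth function commute:
`∂_v ∂_w f = ∂_w ∂_v f`. [folklore] -/
theorem iterDirDeriv_singleton_comm {f : E → F} (hf : ContDiff ℝ ∞ f) (v w : E) :
    iterDirDeriv [v] (iterDirDeriv [w] f) = iterDirDeriv [w] (iterDirDeriv [v] f) := by
  funext x
  have hd : DifferentiableAt ℝ (fderiv ℝ f) x :=
    ((contDiff_infty_iff_fderiv.1 hf).2.differentiable (by simp)) x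
  have hsymm : IsSymmSndFDerivAt ℝ f x :=
    hf.contDiffAt.isSymmSndFDerivAt (by
      rw [minSmoothness_of_isRCLikeNormedField]; exact WithTop.coe_le_coe.2 le_top)
  show fderiv ℝ (fun y => fderiv ℝ f y w) x v = fderiv ℝ (fun y => fderiv ℝ f y v) x w
  rw [fderiv_clm_apply hd (differentiableAt_const _),
    fderiv_clm_apply hd (differentiableAt_const _)]
  simp only [fderiv_fun_const, Pi.zero_apply, ContinuousLinearMap.comp_zero, zero_add,
    ContinuousLinearMap.flip_apply]
  exact hsymm _ _

/-- For smooth `f`, `iterDirDeriv β f` depends only on the word `β` up to permutation.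
[folklore] -/
theorem iterDirDeriv_perm {f : E → F} (hf : ContDiff ℝ ∞ f) {β β' : List E} (h : β.Perm β') :
    iterDirDeriv β f = iterDirDeriv β' f := by
  induction h with
  | nil => rfl
  | @cons v l₁ l₂ _ ih =>
      show iterDirDeriv [v] (iterDirDeriv l₁ f) = iterDirDeriv [v] (iterDirDeriv l₂ f)
      rw [ih]
  | swap v w β =>
      show iterDirDeriv [w] (iterDirDeriv [v] (iterDirDeriv β f)) =
        iterDirDeriv [v] (iterDirDeriv [w] (iterDirDeriv β f))
      exact iterDirDeriv_singleton_comm (contDiff_iterDirDeriv hf β) w v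
  | trans _ _ ih₁ ih₂ => exact ih₁.trans ih₂

/-! ### Third-order Leibniz expansion and remainder -/

/-- **Exact third-order Leibniz expansion** of `∂_{v₁}∂_{v₂}∂_{v₃} (φ κ)` into eight terms (no
commutation of derivatives is used). [folklore] -/
theorem iterDirDeriv_three_mul {φ κ : E → ℝ} (hφ : ContDiff ℝ ∞ φ) (hκ : ContDiff ℝ ∞ κ)
    (v₁ v₂ v₃ : E) :
    iterDirDeriv [v₁, v₂, v₃] (fun x => φ x * κ x) = fun x =>
      φ x * iterDirDeriv [v₁, v₂, v₃] κ x +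
        (iterDirDeriv [v₁, v₂, v₃] φ x * κ x + iterDirDeriv [v₂, v₃] φ x * iterDirDeriv [v₁] κ x +
          iterDirDeriv [v₁, v₃] φ x * iterDirDeriv [v₂] κ x +
          iterDirDeriv [v₃] φ x * iterDirDeriv [v₁, v₂] κ x +
          iterDirDeriv [v₁, v₂] φ x * iterDirDeriv [v₃] κ x +
          iterDirDeriv [v₂] φ x * iterDirDeriv [v₁, v₃] κ x +
          iterDirDeriv [v₁] φ x * iterDirDeriv [v₂, v₃] κ x) := by
  have dφ : ∀ β : List E, Differentiable ℝ (iterDirDeriv β φ) := differentiable_iterDirDeriv hφ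
  have dκ : ∀ β : List E, Differentiable ℝ (iterDirDeriv β κ) := differentiable_iterDirDeriv hκ
  -- everything in nested one-letter form
  show iterDirDeriv [v₁] (iterDirDeriv [v₂] (iterDirDeriv [v₃] fun x => φ x * κ x)) = fun x =>
      φ x * iterDirDeriv [v₁] (iterDirDeriv [v₂] (iterDirDeriv [v₃] κ)) x +
        (iterDirDeriv [v₁] (iterDirDeriv [v₂] (iterDirDeriv [v₃] φ)) x * κ x +
          iterDirDeriv [v₂] (iterDirDeriv [v₃] φ) x * iterDirDeriv [v₁] κ x +
          iterDirDeriv [v₁] (iterDirDeriv [v₃] φ) x * iterDirDeriv [v₂] κ x +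
          iterDirDeriv [v₃] φ x * iterDirDeriv [v₁] (iterDirDeriv [v₂] κ) x +
          iterDirDeriv [v₁] (iterDirDeriv [v₂] φ) x * iterDirDeriv [v₃] κ x +
          iterDirDeriv [v₂] φ x * iterDirDeriv [v₁] (iterDirDeriv [v₃] κ) x +
          iterDirDeriv [v₁] φ x * iterDirDeriv [v₂] (iterDirDeriv [v₃] κ) x)
  have h3 : iterDirDeriv [v₃] (fun x => φ x * κ x) =
      fun x => iterDirDeriv [v₃] φ x * κ x + φ x * iterDirDeriv [v₃] κ x :=
    iterDirDeriv_singleton_mul (dφ []) (dκ []) v₃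
  have h2 : iterDirDeriv [v₂] (iterDirDeriv [v₃] fun x => φ x * κ x) = fun x =>
      (iterDirDeriv [v₂] (iterDirDeriv [v₃] φ) x * κ x +
          iterDirDeriv [v₃] φ x * iterDirDeriv [v₂] κ x) +
        (iterDirDeriv [v₂] φ x * iterDirDeriv [v₃] κ x +
          φ x * iterDirDeriv [v₂] (iterDirDeriv [v₃] κ) x) := by
    rw [h3, iterDirDeriv_singleton_add (f := fun x => iterDirDeriv [v₃] φ x * κ x)
        (g := fun x => φ x * iterDirDeriv [v₃] κ x) ((dφ [v₃]).mul (dκ []))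
        ((dφ []).mul (dκ [v₃])),
      iterDirDeriv_singleton_mul (f := iterDirDeriv [v₃] φ) (g := κ) (dφ [v₃]) (dκ []),
      iterDirDeriv_singleton_mul (f := φ) (g := iterDirDeriv [v₃] κ) (dφ []) (dκ [v₃])]
  rw [h2, iterDirDeriv_singleton_add
      (f := fun x => iterDirDeriv [v₂] (iterDirDeriv [v₃] φ) x * κ x +
        iterDirDeriv [v₃] φ x * iterDirDeriv [v₂] κ x)
      (g := fun x => iterDirDeriv [v₂] φ x * iterDirDeriv [v₃] κ x +
        φ x * iterDirDeriv [v₂] (iterDirDeriv [v₃] κ) x)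
      (((dφ [v₂, v₃]).mul (dκ [])).add ((dφ [v₃]).mul (dκ [v₂])))
      (((dφ [v₂]).mul (dκ [v₃])).add ((dφ []).mul (dκ [v₂, v₃]))),
    iterDirDeriv_singleton_add (f := fun x => iterDirDeriv [v₂] (iterDirDeriv [v₃] φ) x * κ x)
      (g := fun x => iterDirDeriv [v₃] φ x * iterDirDeriv [v₂] κ x)
      ((dφ [v₂, v₃]).mul (dκ [])) ((dφ [v₃]).mul (dκ [v₂])),
    iterDirDeriv_singleton_add (f := fun x => iterDirDeriv [v₂] φ x * iterDirDeriv [v₃] κ x)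
      (g := fun x => φ x * iterDirDeriv [v₂] (iterDirDeriv [v₃] κ) x)
      ((dφ [v₂]).mul (dκ [v₃])) ((dφ []).mul (dκ [v₂, v₃])),
    iterDirDeriv_singleton_mul (f := iterDirDeriv [v₂] (iterDirDeriv [v₃] φ)) (g := κ)
      (dφ [v₂, v₃]) (dκ []),
    iterDirDeriv_singleton_mul (f := iterDirDeriv [v₃] φ) (g := iterDirDeriv [v₂] κ)
      (dφ [v₃]) (dκ [v₂]),
    iterDirDeriv_singleton_mul (f := iterDirDeriv [v₂] φ) (g := iterDirDeriv [v₃] κ)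
      (dφ [v₂]) (dκ [v₃]),
    iterDirDeriv_singleton_mul (f := φ) (g := iterDirDeriv [v₂] (iterDirDeriv [v₃] κ))
      (dφ []) (dκ [v₂, v₃])]
  funext x
  ring

/-- **Leibniz remainder bound.** If the word derivatives of `φ` along the non-empty sublists of
`[v₁, v₂, v₃]` are bounded by `Mφ` at `x`, and those of `κ` along the proper sublists by `Mκ`,
then `|∂_{v₁}∂_{v₂}∂_{v₃}(φκ)(x) - φ(x) ∂_{v₁}∂_{v₂}∂_{v₃}κ(x)| ≤ 7 Mφ Mκ`. [folklore] -/
theorem abs_iterDirDeriv_three_mul_sub_le {φ κ : E → ℝ} (hφ : ContDiff ℝ ∞ φ)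
    (hκ : ContDiff ℝ ∞ κ) {v₁ v₂ v₃ : E} {Mφ Mκ : ℝ} {x : E}
    (hφb : ∀ β : List E, β ≠ [] → β.Sublist [v₁, v₂, v₃] → |iterDirDeriv β φ x| ≤ Mφ)
    (hκb : ∀ β : List E, β ≠ [v₁, v₂, v₃] → β.Sublist [v₁, v₂, v₃] → |iterDirDeriv β κ x| ≤ Mκ) :
    |iterDirDeriv [v₁, v₂, v₃] (fun x => φ x * κ x) x - φ x * iterDirDeriv [v₁, v₂, v₃] κ x| ≤
      7 * Mφ * Mκ := by
  rw [iterDirDeriv_three_mul hφ hκ]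
  simp only [add_sub_cancel_left]
  have hMφ : 0 ≤ Mφ := (abs_nonneg _).trans (hφb [v₁] (by simp) (by simp))
  have t1 : |iterDirDeriv [v₁, v₂, v₃] φ x * κ x| ≤ Mφ * Mκ := by
    rw [abs_mul]; exact mul_le_mul (hφb _ (by simp) (by simp))
      (hκb [] (by simp) (by simp)) (abs_nonneg _) hMφ
  have t2 : |iterDirDeriv [v₂, v₃] φ x * iterDirDeriv [v₁] κ x| ≤ Mφ * Mκ := by
    rw [abs_mul]; exact mul_le_mul (hφb _ (by simp) (by simp))
      (hκb [v₁] (by simp) (by simp)) (abs_nonneg _) hMφ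
  have t3 : |iterDirDeriv [v₁, v₃] φ x * iterDirDeriv [v₂] κ x| ≤ Mφ * Mκ := by
    rw [abs_mul]; exact mul_le_mul (hφb _ (by simp) (by simp))
      (hκb [v₂] (by simp) (by simp)) (abs_nonneg _) hMφ
  have t4 : |iterDirDeriv [v₃] φ x * iterDirDeriv [v₁, v₂] κ x| ≤ Mφ * Mκ := by
    rw [abs_mul]; exact mul_le_mul (hφb _ (by simp) (by simp))
      (hκb [v₁, v₂] (by simp) (by simp)) (abs_nonneg _) hMφ
  have t5 : |iterDirDeriv [v₁, v₂] φ x * iterDirDeriv [v₃] κ x| ≤ Mφ * Mκ := by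
    rw [abs_mul]; exact mul_le_mul (hφb _ (by simp) (by simp))
      (hκb [v₃] (by simp) (by simp)) (abs_nonneg _) hMφ
  have t6 : |iterDirDeriv [v₂] φ x * iterDirDeriv [v₁, v₃] κ x| ≤ Mφ * Mκ := by
    rw [abs_mul]; exact mul_le_mul (hφb _ (by simp) (by simp))
      (hκb [v₁, v₃] (by simp) (by simp)) (abs_nonneg _) hMφ
  have t7 : |iterDirDeriv [v₁] φ x * iterDirDeriv [v₂, v₃] κ x| ≤ Mφ * Mκ := by
    rw [abs_mul]; exact mul_le_mul (hφb _ (by simp) (by simp))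
      (hκb [v₂, v₃] (by simp) (by simp)) (abs_nonneg _) hMφ
  have a6 := abs_add_le (iterDirDeriv [v₁, v₂, v₃] φ x * κ x +
    iterDirDeriv [v₂, v₃] φ x * iterDirDeriv [v₁] κ x +
    iterDirDeriv [v₁, v₃] φ x * iterDirDeriv [v₂] κ x +
    iterDirDeriv [v₃] φ x * iterDirDeriv [v₁, v₂] κ x +
    iterDirDeriv [v₁, v₂] φ x * iterDirDeriv [v₃] κ x +
    iterDirDeriv [v₂] φ x * iterDirDeriv [v₁, v₃] κ x)
    (iterDirDeriv [v₁] φ x * iterDirDeriv [v₂, v₃] κ x)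
  have a5 := abs_add_le (iterDirDeriv [v₁, v₂, v₃] φ x * κ x +
    iterDirDeriv [v₂, v₃] φ x * iterDirDeriv [v₁] κ x +
    iterDirDeriv [v₁, v₃] φ x * iterDirDeriv [v₂] κ x +
    iterDirDeriv [v₃] φ x * iterDirDeriv [v₁, v₂] κ x +
    iterDirDeriv [v₁, v₂] φ x * iterDirDeriv [v₃] κ x)
    (iterDirDeriv [v₂] φ x * iterDirDeriv [v₁, v₃] κ x)
  have a4 := abs_add_le (iterDirDeriv [v₁, v₂, v₃] φ x * κ x +
    iterDirDeriv [v₂, v₃] φ x * iterDirDeriv [v₁] κ x +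
    iterDirDeriv [v₁, v₃] φ x * iterDirDeriv [v₂] κ x +
    iterDirDeriv [v₃] φ x * iterDirDeriv [v₁, v₂] κ x)
    (iterDirDeriv [v₁, v₂] φ x * iterDirDeriv [v₃] κ x)
  have a3 := abs_add_le (iterDirDeriv [v₁, v₂, v₃] φ x * κ x +
    iterDirDeriv [v₂, v₃] φ x * iterDirDeriv [v₁] κ x +
    iterDirDeriv [v₁, v₃] φ x * iterDirDeriv [v₂] κ x)
    (iterDirDeriv [v₃] φ x * iterDirDeriv [v₁, v₂] κ x)
  have a2 := abs_add_le (iterDirDeriv [v₁, v₂, v₃] φ x * κ x +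
    iterDirDeriv [v₂, v₃] φ x * iterDirDeriv [v₁] κ x)
    (iterDirDeriv [v₁, v₃] φ x * iterDirDeriv [v₂] κ x)
  have a1 := abs_add_le (iterDirDeriv [v₁, v₂, v₃] φ x * κ x)
    (iterDirDeriv [v₂, v₃] φ x * iterDirDeriv [v₁] κ x)
  linarith

/-! ### Plane waves -/

/-- `∂_v (c sin ℓ) = (c ℓ v) cos ℓ` for a continuous linear `ℓ`. [folklore] -/
theorem iterDirDeriv_singleton_sin_clm (ℓ : E →L[ℝ] ℝ) (c : ℝ) (v : E) :
    iterDirDeriv [v] (fun x => c * Real.sin (ℓ x)) = fun x => (c * ℓ v) * Real.cos (ℓ x) := by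
  funext x
  have h : HasFDerivAt (fun x => c * Real.sin (ℓ x)) (c • (Real.cos (ℓ x) • (ℓ : E →L[ℝ] ℝ))) x :=
    ((Real.hasDerivAt_sin (ℓ x)).comp_hasFDerivAt x ℓ.hasFDerivAt).const_mul c
  rw [iterDirDeriv_singleton_apply, h.fderiv]
  simp only [smul_apply, smul_eq_mul]
  ring

/-- `∂_v (c cos ℓ) = -(c ℓ v) sin ℓ` for a continuous linear `ℓ`. [folklore] -/
theorem iterDirDeriv_singleton_cos_clm (ℓ : E →L[ℝ] ℝ) (c : ℝ) (v : E) :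
    iterDirDeriv [v] (fun x => c * Real.cos (ℓ x)) = fun x => (-(c * ℓ v)) * Real.sin (ℓ x) := by
  funext x
  have h : HasFDerivAt (fun x => c * Real.cos (ℓ x))
      (c • (-(Real.sin (ℓ x)) • (ℓ : E →L[ℝ] ℝ))) x :=
    ((Real.hasDerivAt_cos (ℓ x)).comp_hasFDerivAt x ℓ.hasFDerivAt).const_mul c
  rw [iterDirDeriv_singleton_apply, h.fderiv]
  simp only [smul_apply, smul_eq_mul]
  ring

/-- `x ↦ c sin(ℓ x)` is smooth. [folklore] -/
theorem contDiff_const_mul_sin_clm (ℓ : E →L[ℝ] ℝ) (c : ℝ) :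
    ContDiff ℝ ∞ fun x => c * Real.sin (ℓ x) :=
  contDiff_const.mul (Real.contDiff_sin.comp ℓ.contDiff)

/-- `x ↦ c cos(ℓ x)` is smooth. [folklore] -/
theorem contDiff_const_mul_cos_clm (ℓ : E →L[ℝ] ℝ) (c : ℝ) :
    ContDiff ℝ ∞ fun x => c * Real.cos (ℓ x) :=
  contDiff_const.mul (Real.contDiff_cos.comp ℓ.contDiff)

/-- The word derivatives of `c sin ℓ` are `± (c ∏_{v ∈ β} ℓ v)` times `sin ℓ` or `cos ℓ`.
[folklore] -/
theorem iterDirDeriv_sin_clm_cases (ℓ : E →L[ℝ] ℝ) (c : ℝ) : ∀ β : List E,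
    (iterDirDeriv β (fun x => c * Real.sin (ℓ x)) =
        fun x => (c * (β.map ℓ).prod) * Real.sin (ℓ x)) ∨
    (iterDirDeriv β (fun x => c * Real.sin (ℓ x)) =
        fun x => (c * (β.map ℓ).prod) * Real.cos (ℓ x)) ∨
    (iterDirDeriv β (fun x => c * Real.sin (ℓ x)) =
        fun x => (-(c * (β.map ℓ).prod)) * Real.sin (ℓ x)) ∨
    (iterDirDeriv β (fun x => c * Real.sin (ℓ x)) =
        fun x => (-(c * (β.map ℓ).prod)) * Real.cos (ℓ x))
  | [] => Or.inl (by simp)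
  | v :: β => by
      rcases iterDirDeriv_sin_clm_cases ℓ c β with h | h | h | h <;>
        rw [iterDirDeriv_cons_eq_singleton, h]
      · right; left
        rw [iterDirDeriv_singleton_sin_clm]; funext x
        simp only [List.map_cons, List.prod_cons]; ring
      · right; right; left
        rw [iterDirDeriv_singleton_cos_clm]; funext x
        simp only [List.map_cons, List.prod_cons]; ring
      · right; right; right
        rw [iterDirDeriv_singleton_sin_clm]; funext x
        simp only [List.map_cons, List.prod_cons]; ring
      · left
        rw [iterDirDeriv_singleton_cos_clm]; funext x
        simp only [List.map_cons, List.prod_cons]; ring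

/-- **Plane-wave derivative bound**: `|∂^β (c sin ℓ)(x)| ≤ |c| ∏_{v ∈ β} |ℓ v|`. [folklore] -/
theorem abs_iterDirDeriv_sin_clm_le (ℓ : E →L[ℝ] ℝ) (c : ℝ) (β : List E) (x : E) :
    |iterDirDeriv β (fun x => c * Real.sin (ℓ x)) x| ≤ |c| * (β.map fun v => |ℓ v|).prod := by
  have hprod : |(β.map ℓ).prod| = (β.map fun v => |ℓ v|).prod := by
    induction β with
    | nil => simp
    | cons v β ih => rw [List.map_cons, List.prod_cons, abs_mul, ih, List.map_cons, List.prod_cons]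
  rcases iterDirDeriv_sin_clm_cases ℓ c β with h | h | h | h <;> rw [h] <;>
    simp only [abs_mul, abs_neg, ← hprod] <;>
    first
    | exact mul_le_of_le_one_right (by positivity) (Real.abs_sin_le_one _)
    | exact mul_le_of_le_one_right (by positivity) (Real.abs_cos_le_one _)

/-- The third derivative of `c sin ℓ` along `v₁, v₂, v₃` is `-(c ℓv₁ ℓv₂ ℓv₃) cos ℓ`. [folklore] -/
theorem iterDirDeriv_three_sin_clm (ℓ : E →L[ℝ] ℝ) (c : ℝ) (v₁ v₂ v₃ : E) :
    iterDirDeriv [v₁, v₂, v₃] (fun x => c * Real.sin (ℓ x)) =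
      fun x => (-(c * ℓ v₁ * ℓ v₂ * ℓ v₃)) * Real.cos (ℓ x) := by
  rw [iterDirDeriv_cons_eq_singleton, iterDirDeriv_cons_eq_singleton v₂,
    iterDirDeriv_singleton_sin_clm, iterDirDeriv_singleton_cos_clm, iterDirDeriv_singleton_sin_clm]
  funext x; ring

omit [NormedSpace ℝ E] in
/-- `∏ᵢ ‖βᵢ‖ = ∏_{v ∈ β} ‖v‖` (to feed `norm_iterDirDeriv_le` with words). [folklore] -/
theorem prod_norm_get : ∀ β : List E, ∏ i : Fin β.length, ‖β.get i‖ = (β.map fun v => ‖v‖).prod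
  | [] => by simp
  | v :: β => by
      show ∏ i : Fin (β.length + 1), ‖(v :: β).get i‖ = _
      rw [Fin.prod_univ_succ, List.map_cons, List.prod_cons, ← prod_norm_get β]
      rfl

end General

end Literature.Analysis.FunctionSpaces

end
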